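import Literature.Analysis.FluidPDE.TaoAveragedSymbolExtraction
import HarnessLib

/-!
# Tao 2016, §3.6–§3.9: the rotation-averaging identity (3.13), decomposed — plane-wave
synthesis of joint weights (§3.6, last paragraph) and rotation averaging with a joint weight
((3.15)–(3.24))

T. Tao, *Finite time blowup for an averaged three-dimensional Navier–Stokes equation*,
J. Amer. Math. Soc. **29** (2016), 601–674 = arXiv:1402.0290v3 (held as `paper:arxiv-1402.0290`;
all numbers are those of that text), §3.6–§3.9, pp. 18–20.

The named fact `rotationAverage_tensorIdentity` (`TaoAveragedSymbolExtraction.lean`: the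
integrated form of (3.13), to which §3.5 reduces the single-scale representation (3.9) and hence
Theorem 3.2) asks for a *complex averaging datum* (Def. 3.4: per-slot symbols
`m_{j,ω}(ξⱼ) ∈ 𝓜₀ ⊗ ℂ` obeying (3.5), rotations `R_{j,ω}`) reproducing `∏ⱼ ∫ Xⱼ · \overline{ψ̂ⱼ}`.
Tao obtains it in two moves, which this file separates into two named facts (each a
`Prop`-valued definition, not asserted) and glues:

1. `rotationAverage_jointWeight` — **§3.6 (3.15)–(3.16) with §3.7–§3.9**: over a finite measure
   space of rotation triples `(R₁, R₂, R₃)` (Tao's `U ⊂ SO(3)³` with Haar measure; here any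
   finite measure `μ₀` on a parameter space `Fin d → ℝ³` and measurable `SO(3)`-valued maps
   `Eⱼ`) and with a *joint* smooth compactly supported weight `F(ω, ξ₁, ξ₂)` (Tao's `F̃'`, "`F'`
   multiplied by some Jacobian factors", smoothly extended and truncated), the frequency-side
   average of `Λ` reproduces `∏ⱼ ∫ Xⱼ · \overline{ψ̂ⱼ}` for all frequency functions `Xⱼ ∈ L¹ ∩ L²`
   with `Xⱼ(ξ) ⊥ ξ` a.e. (the class of `û` for `u ∈ H¹⁰_df ⊗ ℂ`): the manifold `Σ` and its slices,
   (3.16), the implicit function theorem and the rotations `R^θ_ξ` about the axes `ξ̃ⱼ`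
   (3.17)–(3.20), rotation angles and `Θ` (3.21)–(3.23), Fourier inversion on `(ℝ/2πℤ)³` and the
   non-degeneracy (3.24);
2. `planeWaveSynthesis` — **§3.6, last paragraph** ("By a Fourier expansion and another smooth
   truncation, we may thus write `F̃'(R₁,R₂,R₃,ξ₁,ξ₂,ξ₃) = ∫ f(R₁,R₂,R₃,x₁,x₂,x₃) ∏ⱼ (e^{2πi xⱼ·ξⱼ} mⱼ(ξⱼ)) dx₁dx₂dx₃`
   … Inserting this expansion into (3.16), we obtain the desired expansion (3.15) (taking `Ω` to
   be `U × ℝ³ × ℝ³ × ℝ³`, with `μ` being Haar measure weighted by `|f|`, choosing the `m_{j,ω}` to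
   be an appropriately rotated version of `mⱼ`, twisted by a plane wave, and with `F := f/|f|`)"):
   every frequency-side average with a joint smooth compactly supported weight over a measurable
   family of rotations *is* the `Ω`-integral of the frequency-side integrand
   (`ComplexAveragingDatum.freqSideIntegrand`) of a genuine dilation-free complex averaging datum,
   whose symbols are plane-wave-twisted bumps and whose measure is `μ₀ ⊗ |f̂| dx`, the
   integrability conditions (3.5) coming from the rapid decay of `f̂`.

`rotationAverage_tensorIdentity_of_steps` assembles them (with `H¹⁰ ⊂ 𝓕(L¹ ∩ L²)`,
`MemH10dfC.freqIntegrable_fourierFn`), and `singleScale_isComplexAverageNoDil_of_steps` records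
the resulting reduction of the §3.5–§3.9 named fact `singleScale_isComplexAverageNoDil`
(`TaoAveragedCascadeSteps.lean`) to the two facts of this file.

## References

* T. Tao, J. Amer. Math. Soc. 29 (2016), 601–674, arXiv:1402.0290v3, §3.1 Def. 3.4 (3.4)–(3.5),
  §3.5 (3.13), §3.6 pp. 18 ((3.14)–(3.16)), §3.7–§3.9 pp. 18–20 ((3.17)–(3.24)). Key
  `Tao2016AveragedNS`.
-/

noncomputable section

open MeasureTheory Set Filter FourierTransform
open scoped ENNReal NNReal SchwartzMap ComplexConjugate

namespace Literature.Analysis.FluidPDE.Tao2016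

/-- Local notation for physical / frequency space `ℝ³`. -/
local notation "ℝ³" => EuclideanSpace ℝ (Fin 3)
/-- Local notation for the complexified range `ℂ³`. -/
local notation "ℂ³" => EuclideanSpace ℂ (Fin 3)

/-! ### Frequency functions: the class of `û`, `u ∈ H¹⁰_df ⊗ ℂ` -/

/-- A frequency function in `L¹ ∩ L²` (the integrability of `û` for `u ∈ H¹⁰`, Tao p. 3 and
p. 7: what makes the trilinear frequency integrals converge absolutely). [cite: Tao2016AveragedNS, §1.1 p. 7] -/
def FreqIntegrable (X : ℝ³ → ℂ³) : Prop :=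
  Integrable X (volume : Measure ℝ³) ∧ MemLp X 2 (volume : Measure ℝ³)

/-- A frequency function with `X(ξ) · ξ = 0` for a.e. `ξ` ("`û(ξ₁) ∈ ξ₁^⊥` for (almost) all
`ξ₁`", Tao p. 3; the condition `Xⱼ ∈ ξⱼ^⊥` of (3.13)). [cite: Tao2016AveragedNS, §1.1 p. 3 and §3.5 (3.13)] -/
def FreqDivFree (X : ℝ³ → ℂ³) : Prop :=
  ∀ᵐ ξ ∂(volume : Measure ℝ³), cdot (FunctionSpaces.EuclideanSpace.complexify ξ) (X ξ) = 0

/-- **`H¹⁰ ⊂ 𝓕(L¹ ∩ L²)`**: for `u ∈ H¹⁰_df ⊗ ℂ`, `û ∈ L¹ ∩ L²` (Cauchy–Schwarz against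
`(1+|ξ|²)^{-10} ∈ L¹(ℝ³)`, `lintegral_enorm_le_sobolevWeight`). [cite: Tao2016AveragedNS, §1.1 p. 7] -/
theorem MemH10dfC.freqIntegrable_fourierFn {u : L2C} (hu : MemH10dfC u) :
    FreqIntegrable (fourierFn u) := by
  refine ⟨⟨aestronglyMeasurable_fourierFn u, ?_⟩, Lp.memLp (𝓕 u : L2C)⟩
  have h10 : sobolevWeightIntegral 10 (fourierFn u) < ∞ :=
    (eFourierSobolevNorm_lt_top_iff 10 u).1 hu.1
  refine lt_of_le_of_lt (lintegral_enorm_le_sobolevWeight (aestronglyMeasurable_fourierFn u)) ?_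
  exact ENNReal.mul_lt_top
    (ENNReal.rpow_lt_top_of_nonneg (by norm_num) lintegral_inv_sobolevWeight_lt_top.ne)
    (ENNReal.rpow_lt_top_of_nonneg (by norm_num) h10.ne)

/-- For `u ∈ H¹⁰_df ⊗ ℂ`, `û(ξ) ⊥ ξ` a.e. [cite: Tao2016AveragedNS, §1.1 p. 3] -/
theorem MemH10dfC.freqDivFree_fourierFn {u : L2C} (hu : MemH10dfC u) :
    FreqDivFree (fourierFn u) :=
  hu.2

/-! ### Frequency-side averages with a joint weight over a family of rotations -/

/-- The **single-scale weight** `φ(|ξ₁ - ξ₁⁰|/ε₀²) η(|ξ₁|,|ξ₂|,|ξ₃|)` of `B_{η,ρ,0}` ((3.9),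
(3.13)), as a function of `(ξ₁, ξ₂)`, `ξ₃ = -ξ₁-ξ₂`. [cite: Tao2016AveragedNS, §3.4 (3.9) and §3.5 (3.13)] -/
def singleScaleWeight (ε₀ : ℝ) (p : ℝ³ × ℝ³) : ℝ :=
  freqCutoff (‖p.1 - xi0 0‖ / ε₀ ^ 2) * eta ε₀ ‖p.1‖ ‖p.2‖ ‖-p.1 - p.2‖

/-- A **measurable family of rotations** indexed by a parameter space `V` (Tao's measurable
`R_{i,·} : Ω → SO(3)`, Def. 3.4; for (3.15)–(3.16), the coordinates of `U ⊂ SO(3)³`): each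
`Eⱼ(ω)` is a linear isometry of `ℝ³` of determinant `1`, measurably in `ω` (pointwise, as in
`ComplexAveragingDatum`). [cite: Tao2016AveragedNS, Def. 3.4 and §3.6 p. 18] -/
def IsRotationFamily {V : Type*} [MeasurableSpace V] (E : Fin 3 → V → (ℝ³ ≃ₗᵢ[ℝ] ℝ³)) : Prop :=
  (∀ i ω, LinearMap.det ((E i ω).toLinearEquiv : ℝ³ →ₗ[ℝ] ℝ³) = 1) ∧
    ∀ i (x : ℝ³), Measurable fun ω => E i ω x

/-- The **frequency-side average with a joint weight** `F(ω, ξ₁, ξ₂)` over a family of rotations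
`Eⱼ(ω)` and a measure `μ₀` — the right-hand side of (3.15)/(3.16) after integration against the
frequency functions (the Dirac delta `δ(R₁ξ₁ + R₂ξ₂ + R₃ξ₃)` becoming the parametrisation
`ξ₃ = -ξ₁-ξ₂`, `Xⱼ` evaluated at `Eⱼ(ω)⁻¹ξⱼ`):
`∫_V ∫∫ φ(|ξ₁-ξ₁⁰|/ε₀²) η(|ξ₁|,|ξ₂|,|ξ₃|) F(ω,ξ₁,ξ₂) Λ_{ξ₁,ξ₂,ξ₃}(E₁(ω) X₁(E₁(ω)⁻¹ξ₁), E₂(ω) X₂(E₂(ω)⁻¹ξ₂), E₃(ω) X₃(E₃(ω)⁻¹ξ₃)) dξ₁dξ₂ dμ₀(ω)`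
(Bochner junk `0`). With a product weight `F(ω,ξ₁,ξ₂) = f(ω) m₁(ξ₁) m₂(ξ₂) m₃(ξ₃)` this is the
`μ₀`-integral of `ComplexAveragingDatum.freqSideIntegrand`; Tao's `F̃'` is a genuinely joint
weight. [cite: Tao2016AveragedNS, §3.6 (3.15)–(3.16)] -/
def jointWeightAverage {V : Type*} [MeasurableSpace V] (μ₀ : Measure V)
    (E : Fin 3 → V → (ℝ³ ≃ₗᵢ[ℝ] ℝ³)) (ε₀ : ℝ) (F : V × (ℝ³ × ℝ³) → ℂ)
    (X₁ X₂ X₃ : ℝ³ → ℂ³) : ℂ :=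
  ∫ ω, (∫ p : ℝ³ × ℝ³, ((singleScaleWeight ε₀ p : ℝ) : ℂ) * F (ω, p) *
    Λ p.1 p.2 (rotMat (E 0 ω) (X₁ ((E 0 ω).symm p.1))) (rotMat (E 1 ω) (X₂ ((E 1 ω).symm p.2)))
      (rotMat (E 2 ω) (X₃ ((E 2 ω).symm (-p.1 - p.2))))) ∂μ₀

/-! ### The two named facts -/

/-- **Tao 2016, §3.6 (last paragraph): plane-wave synthesis of a joint weight — a frequency-side
average with a joint smooth weight is a genuine dilation-free complex average.** For every
finite measure `μ₀` on a parameter space `V = (Fin d → ℝ³)`, every measurable family of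
rotations `Eⱼ : V → SO(3)`, every `ε₀` and every smooth compactly supported joint weight
`F : V × ℝ³ × ℝ³ → ℂ`, there is a complex averaging datum `𝒟` (Def. 3.4, integrability
conditions (3.5) included) with `λ ≡ 1` whose frequency-side integrand
(`ComplexAveragingDatum.freqSideIntegrand`: per-slot symbols `m_{j,θ}(ξⱼ)`, rotations `R_{j,θ}`)
integrates to the joint-weight average: for all `X₁, X₂, X₃ ∈ L¹ ∩ L²`,
`∫_Ω (freqSideIntegrand) dμ = jointWeightAverage μ₀ E ε₀ F X₁ X₂ X₃`. Printed construction: "By a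
Fourier expansion and another smooth truncation, we may thus write
`F̃'(R₁,R₂,R₃,ξ₁,ξ₂,ξ₃) = ∫_{ℝ³×ℝ³×ℝ³} f(R₁,R₂,R₃,x₁,x₂,x₃) ∏ⱼ (e^{2πi xⱼ·ξⱼ} mⱼ(ξⱼ)) dx₁dx₂dx₃` …
where `mⱼ` is a smooth function supported on `B(ξⱼ⁰, 3ε₀³)`, and `f` … is rapidly decreasing in
`x₁,x₂,x₃`, uniformly in `R₁,R₂,R₃`. Inserting this expansion into (3.16), we obtain the desired
expansion (3.15) (taking `Ω` to be `U × ℝ³ × ℝ³ × ℝ³`, with `μ` being Haar measure weighted by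
`|f|`, choosing the `m_{j,ω}` to be an appropriately rotated version of `mⱼ`, twisted by a plane
wave, and with `F := f/|f|`)" — here over a general finite `μ₀` in place of Haar measure on `U`,
with the `ω`-dependence of `F` expanded in plane waves as well (absorbed into `m_{1,θ}` as a unimodular
factor), the rotations `R_{j,(ω,x)} = Eⱼ(ω)`, and (3.5) from `‖e^{2πi x·ξ} m(ξ)‖_k ≲ (1+|x|)ᵏ` and
the decay of `f̂`; the exchange of the `x`- and `ξ`-integrals uses `Xⱼ ∈ L¹ ∩ L²` (Fubini). A
`Prop`-valued definition, not asserted. [cite: Tao2016AveragedNS, §3.6 p. 18 and Def. 3.4 (3.5)] -/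
def planeWaveSynthesis : Prop :=
  ∀ (d : ℕ) (μ₀ : Measure (Fin d → ℝ³)), IsFiniteMeasure μ₀ →
    ∀ E : Fin 3 → (Fin d → ℝ³) → (ℝ³ ≃ₗᵢ[ℝ] ℝ³), IsRotationFamily E →
      ∀ (ε₀ : ℝ) (F : (Fin d → ℝ³) × (ℝ³ × ℝ³) → ℂ),
        ContDiff ℝ ((⊤ : ℕ∞) : WithTop ℕ∞) F → HasCompactSupport F →
          ∃ 𝒟 : ComplexAveragingDatum, (∀ i θ, 𝒟.lam i θ = 1) ∧
            ∀ X₁ X₂ X₃ : ℝ³ → ℂ³, FreqIntegrable X₁ → FreqIntegrable X₂ → FreqIntegrable X₃ →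
              ∫ θ, 𝒟.freqSideIntegrand ε₀ θ X₁ X₂ X₃ ∂𝒟.μ = jointWeightAverage μ₀ E ε₀ F X₁ X₂ X₃

/-- **Tao 2016, §3.6 (3.15)–(3.16) with §3.7–§3.9: rotation averaging with a joint weight.** For
`ε₀ > 0` below an absolute threshold and normalised profiles `ψⱼ` (`ψ̂ⱼ ⊆ B(ξⱼ⁰, ε₀³)`, (3.7))
there are a parameter space `V = (Fin d → ℝ³)` with a finite measure `μ₀` (Tao: the open set
`U = {(R₁,R₂,R₃) ∈ SO(3)³ : |Rⱼξⱼ⁰ - ξⱼ⁰| < ε₀²/4}` with Haar measure, in coordinates), a measurable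
family of rotations `Eⱼ : V → SO(3)` and a smooth compactly supported joint weight
`F : V × ℝ³ × ℝ³ → ℂ` (Tao's `F̃'`, contracted against `\overline{ψ̂₁} ⊗ \overline{ψ̂₂} ⊗ \overline{ψ̂₃}`)
such that for all frequency functions `X₁, X₂, X₃ ∈ L¹ ∩ L²` with `Xⱼ(ξ) ⊥ ξ` a.e.,
`jointWeightAverage μ₀ E ε₀ F X₁ X₂ X₃ = ∏ⱼ ∫ Xⱼ(ξ) · \overline{ψ̂ⱼ(ξ)} dξ`
— the integrated form of (3.15) `X₁ ⊗ X₂ ⊗ X₃ = ∫_Ω δ(R_{1,ω}ξ₁ + R_{2,ω}ξ₂ + R_{3,ω}ξ₃) F(ω) m_{1,ω}(R_{1,ω}ξ₁) m_{2,ω}(R_{2,ω}ξ₂) m_{3,ω}(R_{3,ω}ξ₃) Λ_{R_{1,ω}ξ₁,R_{2,ω}ξ₂,R_{3,ω}ξ₃}(R_{1,ω}X₁, R_{2,ω}X₂, R_{3,ω}X₃) dμ(ω)`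
(for `ξⱼ ∈ B(ξⱼ⁰, ε₀³)`, `Xⱼ ∈ ξⱼ^⊥`; restricting to rotations with `|R_{j,ω}ξⱼ⁰ - ξⱼ⁰| < ε₀²/2`,
(3.14), makes the weight `φ η` equal to one) in the form (3.16)/"by a change of variables":
`X₁ ⊗ X₂ ⊗ X₃ = ∫_U δ(R₁ξ₁ + R₂ξ₂ + R₃ξ₃) F̃'(R₁,R₂,R₃,ξ₁,ξ₂,ξ₃) Λ_{R₁ξ₁,R₂ξ₂,R₃ξ₃}(R₁X₁, R₂X₂, R₃X₃) dR₁dR₂dR₃`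
with a joint smooth weight `F̃'`. Printed proof: the 15-dimensional manifold `Σ` and its
6-dimensional slices `Σ_{ξ₁,ξ₂,ξ₃}` (§3.6); closing rotations `R_{j,ξ₁,ξ₂,ξ₃} = I + O(ε₀³)` from the
implicit function theorem, `ξ̃ⱼ = R_{j,ξ}ξⱼ ∈ Γ`, the ansatz `Rⱼ = S R^{θⱼ}_{ξ̃ⱼ} R_{j,ξ}` (3.19) and the
reduction to (3.20) on `(ℝ/2πℤ)³ × Γ`, averaging over `‖S - I‖ ≤ ε₀²/8` (§3.7); the unit normal `n`,
`Yⱼ = R^{αⱼ}_{ηⱼ} n` and `Θ_{η₁,η₂,η₃}` (3.21)–(3.23) (§3.8); the expansion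
`Θ = Σ_σ c_σ e^{i(σ₁γ₁+σ₂γ₂+σ₃γ₃)}`, Fourier inversion on `(ℝ/2πℤ)³` and the non-degeneracy (3.24)
`c_σ = -(1/8i)(-σ₁ + σ₂/√2 + σ₁σ₂σ₃/√2) + O(ε₀) ≠ 0` for the normalisation (3.7) (§3.9). A
`Prop`-valued definition, not asserted. [cite: Tao2016AveragedNS, §3.6–3.9 (3.14)–(3.24)] -/
def rotationAverage_jointWeight : Prop :=
  ∃ ε₁ : ℝ, 0 < ε₁ ∧ ∀ ε₀ : ℝ, 0 < ε₀ → ε₀ ≤ ε₁ →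
    ∀ ψ : Fin 3 → 𝓢(ℝ³, ℂ³), NormalisedProfiles ε₀ ψ →
      ∃ (d : ℕ) (μ₀ : Measure (Fin d → ℝ³)), IsFiniteMeasure μ₀ ∧
        ∃ E : Fin 3 → (Fin d → ℝ³) → (ℝ³ ≃ₗᵢ[ℝ] ℝ³), IsRotationFamily E ∧
          ∃ F : (Fin d → ℝ³) × (ℝ³ × ℝ³) → ℂ,
            ContDiff ℝ ((⊤ : ℕ∞) : WithTop ℕ∞) F ∧ HasCompactSupport F ∧
              ∀ X₁ X₂ X₃ : ℝ³ → ℂ³, FreqIntegrable X₁ → FreqIntegrable X₂ → FreqIntegrable X₃ →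
                FreqDivFree X₁ → FreqDivFree X₂ → FreqDivFree X₃ →
                  jointWeightAverage μ₀ E ε₀ F X₁ X₂ X₃ =
                    (∫ ξ, cdot (X₁ ξ) (conj3 (𝓕 (⇑(ψ 0)) ξ))) *
                      (∫ ξ, cdot (X₂ ξ) (conj3 (𝓕 (⇑(ψ 1)) ξ))) *
                        ∫ ξ, cdot (X₃ ξ) (conj3 (𝓕 (⇑(ψ 2)) ξ))

/-! ### Assembly -/

/-- **(3.13) from its two halves** (Tao 2016, §3.6: "Inserting this expansion into (3.16), we
obtain the desired expansion (3.15)"): `rotationAverage_tensorIdentity` from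
`rotationAverage_jointWeight` (§3.6–§3.9 with a joint weight) and `planeWaveSynthesis` (§3.6,
plane waves), with the threshold of the former; `û, v̂, ŵ ∈ L¹ ∩ L²` and `⊥ ξ` a.e. for
`u, v, w ∈ H¹⁰_df ⊗ ℂ`. [cite: Tao2016AveragedNS, §3.6 p. 18] -/
theorem rotationAverage_tensorIdentity_of_steps (hA : planeWaveSynthesis)
    (hB : rotationAverage_jointWeight) : rotationAverage_tensorIdentity := by
  obtain ⟨ε₁, hε₁, hB⟩ := hB
  refine ⟨ε₁, hε₁, fun ε₀ hε₀ hle ψ hψ => ?_⟩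
  obtain ⟨d, μ₀, hμ₀, E, hE, F, hF, hFc, hid⟩ := hB ε₀ hε₀ hle ψ hψ
  obtain ⟨𝒟, hlam, h𝒟⟩ := hA d μ₀ hμ₀ E hE ε₀ F hF hFc
  refine ⟨𝒟, hlam, fun u v w hu hv hw => ?_⟩
  rw [h𝒟 _ _ _ hu.freqIntegrable_fourierFn hv.freqIntegrable_fourierFn hw.freqIntegrable_fourierFn]
  exact hid _ _ _ hu.freqIntegrable_fourierFn hv.freqIntegrable_fourierFn hw.freqIntegrable_fourierFn
    hu.freqDivFree_fourierFn hv.freqDivFree_fourierFn hw.freqDivFree_fourierFn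

/-- **§3.5–§3.9 reduced to the two facts of this file**: `singleScale_isComplexAverageNoDil`
(`TaoAveragedCascadeSteps.lean`) from `planeWaveSynthesis` and `rotationAverage_jointWeight`, via
`singleScale_isComplexAverageNoDil_of_tensorIdentity` (§3.5). [cite: Tao2016AveragedNS, §3.5–3.9] -/
theorem singleScale_isComplexAverageNoDil_of_steps (hA : planeWaveSynthesis)
    (hB : rotationAverage_jointWeight) : singleScale_isComplexAverageNoDil :=
  singleScale_isComplexAverageNoDil_of_tensorIdentity (rotationAverage_tensorIdentity_of_steps hA hB)

end Literature.Analysis.FluidPDE.Tao2016
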